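import Literature.NumberTheory.LFunctions.Zhang2022.KnifeEdgeThreePiece
import Literature.NumberTheory.LFunctions.Zhang2022.KnifeEdgeOffDiagForm

/-!
# Zhang (2022), barrier-extension programme — lengths beyond `P` are INDEPENDENT of the printed off-diagonal input:
# two print-consistent worlds, one in which a two-piece design closes and one in which none does

Y. Zhang, *Discrete mean estimates and the Landau–Siegel zero*, arXiv:2211.02515v1 (2022) [Zhang2022LandauSiegel] —
**unrefereed, under adjudication. WHAT THIS IS NOT: no claim about its Theorems 1–2, Landau–Siegel zeros, Parity or a
repaired `Margin232`; every statement is about the CONTINUED CALCULUS of the manuscript's main terms in an abstract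
off-diagonal world `X` (registry E-017 / E-002 open off `R`).** Cell `landau-siegel` §E, seat p1, stub S-E-p1-8 of
barrier/ASSIGNMENTS.md (planner 2026-08-26T18:44:38Z / 18:48:38Z: CONSISTENCY-MODEL currency; NOT a row of the running
class `Repair.Rplusplus<k>` — no Design/K/Verdict shape; it replaces BARRIER-STATE §2's «lengths ≥ P UNCOVERED» by
«INDEPENDENT of print»).

## The sentence this file types (ls-Blen-plan 2026-08-26T18:46:28Z, KILL(B-len) draft §2 (L-a)/χψ, quoted VERBATIM;
pre-registered, word pending at filing time)

«No χψ design of 𝒟_len with a piece beyond Zhang's wall (top θ ∈ (1,2)) closes criterion (2.32)/(2.33) at main order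
on the strength of the printed inputs: every smooth / bounded-variation structure beyond the near-wall band is
invisible by theorem (tailInvisible(_bv), discMeanFlat(_bv)), the wall-value-0 two-piece designs are decided no in R⁺
(modulo E-004), and in the X-world a two-piece design closes iff the true off-diagonal functional X violates
CompletedCS on it (null_iff_completedCS) — which the printed off-diagonal inputs (no main term for lengths ≤ P:
inPrintOffDiagonalRange_iff_belowP; DiagonalOnly only for Θ < 1: CEILING-len v1) neither assert nor exclude; the only
lever is E-002, the off-diagonal MAIN TERM of the prime family at θ > 1 itself (open-in-print, XL).»

## What is typed

* `PrintConsistent X` — the world carries NO off-diagonal main term on pairs of IN-CLASS pieces (lengths `≤ P`, the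
  range of Prop. 7.1 / (7.2)): the content of the printed off-diagonal inputs as far as the two-piece calculus reads them
  (`Repair.inPrintOffDiagonalRange_iff_belowP`, p459189: the printed range is exactly the wall). `printConsistent_zero`.
* `printNullWorld θ` — a print-consistent world that is `0` against every in-class piece and, beyond the wall, cancels
  the tail coupling and nets the overhang block to zero: `printConsistent_printNullWorld`,
  `invisibleOverhang_printNullWorld` (it is an invisible world for the smooth class, p442741's slot),
  `slots_rough_printNullWorld` (it satisfies E-005/E-006 on the ROUGH class, p457552's slots),
  `worldLinearOn_printNullWorld` (it is linear in the in-class slot, p461544's consistency condition).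
* **`lengthsBeyondP_independent (hθ : 1 < θ)`** (planner's shape): `∃ X₁ X₂, PrintConsistent X₁ ∧ PrintConsistent X₂ ∧
  ClosesByPositivity θ X₁ ∧ ¬ ClosesByPositivity θ X₂` — `X₁ = 0` (the continued calculus, `Repair.closesByPositivity_zero`,
  p456612), `X₂ = printNullWorld θ` (`KnifeEdge.not_closes_of_invisible`); `…_null` with `KnifeEdge.Null θ X₂`;
  `…_rough` on the rough class (`rough_closesByPositivity_zero` / `nullOn_iff`); `…_joint` in the §2 joint currency
  (`Repair.jointCloses_zero` / `KnifeEdge.not_jointCloses_of_slots`). So the printed inputs DECIDE NOTHING about closing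
  beyond `P`, in either currency and on either piece class: the lever is the off-diagonal main term at `θ > 1` itself
  (E-002), exactly as the sentence says.

[cite: Zhang2022LandauSiegel, §7 Prop 7.1, (7.2), (7.11)–(7.15); §2 (2.32)–(2.33)]
-/

noncomputable section

open Real Complex ComplexConjugate Set
open _root_.MeasureTheory

namespace Literature.NumberTheory.LFunctions.Zhang2022

namespace Repair

open KnifeEdge

variable {θ : ℝ} {X : PairFunctional}

/-- **Print-consistent world**: NO off-diagonal main term on pairs of in-class pieces (both supported in `[0,1]`,
lengths `≤ P` — the range (7.2) on which the printed inputs give «diagonal + error», `inPrintOffDiagonalRange_iff_belowP`):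
`X(u,v) = 0` and `X(v,v) = 0` whenever `u`, `v` are in-class. Nothing is said about pairs involving a piece beyond the
wall. [cite: Zhang2022LandauSiegel, §7 Prop 7.1 p.44, (7.2), (7.11)–(7.15)] -/
def PrintConsistent (X : PairFunctional) : Prop :=
  ∀ u u' v v' : ℝ → ℂ, InClassPiece u u' → InClassPiece v v' → X u u' v v' = 0 ∧ X v v' v v' = 0

/-- The continued calculus `X = 0` is print-consistent. [cite: Zhang2022LandauSiegel, §7 Prop 7.1 p.44, (7.2)] -/
theorem printConsistent_zero : PrintConsistent 0 := fun _ _ _ _ _ _ => ⟨rfl, rfl⟩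

open Classical in
/-- **The print-consistent null world** of length `θ`: `0` against every in-class second argument; on a diagonal pair
beyond the wall minus half the real part of the continued diagonal block; on an (in-class, beyond-the-wall) pair minus
the tail coupling; `0` otherwise. [cite: Zhang2022LandauSiegel, §7 Prop 7.1 p.44, (7.2); §8 (8.11)–(8.12)] -/
def printNullWorld (θ : ℝ) : PairFunctional := fun a a' b b' =>
  if InClassPiece b b' then 0
  else if a = b ∧ a' = b' then (((-(topDiagForm θ b b').re / 2 : ℝ)) : ℂ)
  else if InClassPiece a a' then -((π : ℂ) * conj (overhangMass θ b) * tailFunctional a)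
  else 0

/-- `printNullWorld θ` is print-consistent (it vanishes whenever the second piece is in-class).
[cite: Zhang2022LandauSiegel, §7 Prop 7.1 p.44, (7.2)] -/
theorem printConsistent_printNullWorld (θ : ℝ) : PrintConsistent (printNullWorld θ) := by
  intro u u' v v' _ hv
  simp [printNullWorld, hv]

/-- value of `printNullWorld` on an (in-class, not-in-class) pair: minus the tail coupling.
[cite: Zhang2022LandauSiegel, §8 (8.11)–(8.12)] -/
theorem printNullWorld_cross {u u' v v' : ℝ → ℂ} (hu : InClassPiece u u') (hv : ¬ InClassPiece v v') :
    printNullWorld θ u u' v v' = -((π : ℂ) * conj (overhangMass θ v) * tailFunctional u) := by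
  have hne : ¬ (u = v ∧ u' = v') := by rintro ⟨rfl, rfl⟩; exact hv hu
  simp [printNullWorld, hv, hne, hu]

/-- value of `printNullWorld` on a not-in-class diagonal pair: minus half the real part of the continued block.
[cite: Zhang2022LandauSiegel, §7 Prop 7.1 p.44, (7.2)] -/
theorem printNullWorld_diag {v v' : ℝ → ℂ} (hv : ¬ InClassPiece v v') :
    printNullWorld θ v v' v v' = (((-(topDiagForm θ v v').re / 2 : ℝ)) : ℂ) := by
  simp [printNullWorld, hv]

/-- the continued diagonal block of the zero piece vanishes. [cite: Zhang2022LandauSiegel, §8 (8.11)–(8.12)] -/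
theorem topDiagForm_zero_re (θ : ℝ) : (topDiagForm θ (fun _ => (0:ℂ)) (fun _ => (0:ℂ))).re = 0 := by
  simp [topDiagForm, MformTop_zero_left]

/-- **`printNullWorld θ` is an invisible world for the smooth two-piece class** (p442741's slot holds in it).
[cite: Zhang2022LandauSiegel, §7 Prop 7.1 p.44, (7.2)] -/
theorem invisibleOverhang_printNullWorld (θ : ℝ) : InvisibleOverhang θ (printNullWorld θ) := by
  intro u u' v v' hu hv
  by_cases hvi : InClassPiece v v'
  · obtain ⟨h0, h0'⟩ := eq_zero_of_inClass_of_overhang hvi hv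
    subst h0 h0'
    refine ⟨?_, ?_⟩
    · simp [printNullWorld, hvi, overhangMass]
    · simp [printNullWorld, hvi, topDiagForm_zero_re]
  · refine ⟨printNullWorld_cross hu hvi, ?_⟩
    rw [printNullWorld_diag hvi, Complex.ofReal_re]; ring

/-- **`printNullWorld θ` satisfies both slots on the ROUGH class**: every net rough block is `0` (E-005) and every
cross residual against an in-class piece is `0` (E-006). [cite: Zhang2022LandauSiegel, §7 Prop 7.1 p.44, (7.2)] -/
theorem slots_rough_printNullWorld (θ : ℝ) :
    BandNonnegOn (RoughOverhangPiece θ) θ (printNullWorld θ) ∧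
      CrossSubordinateOn (RoughOverhangPiece θ) θ (printNullWorld θ) := by
  have hband : ∀ v v', RoughOverhangPiece θ v v' → netOverhangBlock θ (printNullWorld θ) v v' = 0 := by
    intro v v' hv
    unfold netOverhangBlock
    by_cases hvi : InClassPiece v v'
    · obtain ⟨h0, h0'⟩ := eq_zero_of_inClass_of_rough hvi hv
      subst h0 h0'
      have : printNullWorld θ 0 0 0 0 = 0 := by simp [printNullWorld, hvi]
      rw [this]
      simp [topDiagForm, MformTop, dipoleIntegrandTop]
    · rw [printNullWorld_diag hvi, Complex.ofReal_re]; ring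
  refine ⟨fun v v' hv => (hband v v' hv).ge, fun u u' v v' hu hv => ?_⟩
  rw [hband v v' hv, mul_zero]
  have hc : crossResidual θ (printNullWorld θ) u u' v v' = 0 := by
    unfold crossResidual
    by_cases hvi : InClassPiece v v'
    · obtain ⟨h0, h0'⟩ := eq_zero_of_inClass_of_rough hvi hv
      subst h0 h0'
      have : printNullWorld θ u u' 0 0 = 0 := by simp [printNullWorld, hvi]
      rw [this]
      simp [overhangMass]
    · rw [printNullWorld_cross hu hvi]; ring
  rw [hc, norm_zero]
  norm_num

/-- `printNullWorld θ` is linear in the in-class slot against rough pieces (p461544's consistency condition).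
[cite: Zhang2022LandauSiegel, §7 Prop 7.1 p.44, (7.2)] -/
theorem worldLinearOn_printNullWorld (θ : ℝ) : WorldLinearOn (RoughOverhangPiece θ) (printNullWorld θ) := by
  intro u u' f f' v v' s t hu hf _
  by_cases hvi : InClassPiece v v'
  · simp [printNullWorld, hvi]
  · rw [printNullWorld_cross (hu.add_smul hf s t) hvi, printNullWorld_cross hu hvi, printNullWorld_cross hf hvi,
      tailFunctional_add_smul hu hf]
    ring

/-- **LENGTHS BEYOND `P` ARE INDEPENDENT OF PRINT** (planner's shape, POS currency, smooth class): for every `θ > 1`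
there are two print-consistent worlds — the continued calculus `X₁ = 0`, in which a smooth two-piece design of length
`θ` CLOSES by positivity (`Repair.closesByPositivity_zero`), and the print-consistent null world `X₂`, in which NO smooth
two-piece design closes (`KnifeEdge.not_closes_of_invisible`). The printed off-diagonal inputs say nothing beyond the
wall either way; the lever is E-002. [cite: Zhang2022LandauSiegel, §7 Prop 7.1 p.44, (7.2); §2 (2.32)–(2.33)] -/
theorem lengthsBeyondP_independent (hθ : 1 < θ) :
    ∃ X₁ X₂ : PairFunctional, PrintConsistent X₁ ∧ PrintConsistent X₂ ∧
      ClosesByPositivity θ X₁ ∧ ¬ ClosesByPositivity θ X₂ :=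
  ⟨0, printNullWorld θ, printConsistent_zero, printConsistent_printNullWorld θ, closesByPositivity_zero hθ,
    not_closes_of_invisible (invisibleOverhang_printNullWorld θ)⟩

/-- the same with the NULL stated positively for `X₂` (`KnifeEdge.Null θ X₂`, and completed Cauchy–Schwarz).
[cite: Zhang2022LandauSiegel, §7 Prop 7.1 p.44, (7.2); §2 (2.32)–(2.33)] -/
theorem lengthsBeyondP_independent_null (hθ : 1 < θ) :
    ∃ X₁ X₂ : PairFunctional, PrintConsistent X₁ ∧ PrintConsistent X₂ ∧
      ClosesByPositivity θ X₁ ∧ Null θ X₂ ∧ CompletedCS θ X₂ :=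
  ⟨0, printNullWorld θ, printConsistent_zero, printConsistent_printNullWorld θ, closesByPositivity_zero hθ,
    null_of_invisible (invisibleOverhang_printNullWorld θ), completedCS_of_invisible (invisibleOverhang_printNullWorld θ)⟩

/-- **… on the ROUGH class** (wall jump / top value / interior jumps of the overhang allowed): `X₁ = 0` closes
(`KnifeEdge.rough_closesByPositivity_zero`), `X₂` satisfies both slots, hence the rough null (`KnifeEdge.nullOn_iff`).
[cite: Zhang2022LandauSiegel, §7 Prop 7.1 p.44, (7.2); §2 (2.32)–(2.33)] -/
theorem lengthsBeyondP_independent_rough (hθ : 1 < θ) :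
    ∃ X₁ X₂ : PairFunctional, PrintConsistent X₁ ∧ PrintConsistent X₂ ∧
      ClosesByPositivityOn (RoughOverhangPiece θ) θ X₁ ∧ NullOn (RoughOverhangPiece θ) θ X₂ :=
  ⟨0, printNullWorld θ, printConsistent_zero, printConsistent_printNullWorld θ, rough_closesByPositivity_zero hθ,
    nullOn_iff.2 (slots_rough_printNullWorld θ)⟩

/-- **… in the §2 JOINT currency** (criterion (2.32)/(2.33) against an in-class probe): in `X₁ = 0` the member
`s·g⋆ ⊕ φ_θ` against `g⋆` closes the joint criterion for every `s` (`Repair.jointCloses_zero`), while in `X₂` no rough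
two-piece design closes it against any in-class probe (`KnifeEdge.not_jointCloses_of_slots`).
[cite: Zhang2022LandauSiegel, §2 (2.32)–(2.33); §7 Prop 7.1 p.44, (7.2)] -/
theorem lengthsBeyondP_independent_joint (hθ : 1 < θ) :
    ∃ X₁ X₂ : PairFunctional, PrintConsistent X₁ ∧ PrintConsistent X₂ ∧
      (∀ s : ℂ, twoPieceMainTerm θ X₁ gStar gStar' (phiT θ) (phiT' θ) s * mainTermForm gStar gStar'
          < ‖twoPieceCross θ X₁ gStar gStar' (phiT θ) (phiT' θ) s gStar gStar'‖ ^ 2) ∧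
      (∀ (u u' v v' f f' : ℝ → ℂ) (s : ℂ), InClassPiece u u' → RoughOverhangPiece θ v v' → InClassPiece f f' →
          ¬ (twoPieceMainTerm θ X₂ u u' v v' s * mainTermForm f f' < ‖twoPieceCross θ X₂ u u' v v' s f f'‖ ^ 2)) :=
  ⟨0, printNullWorld θ, printConsistent_zero, printConsistent_printNullWorld θ, fun s => jointCloses_zero hθ s,
    fun _ _ _ _ _ _ s hu hv hf =>
      not_jointCloses_of_slots (worldLinearOn_printNullWorld θ) (slots_rough_printNullWorld θ).1
        (slots_rough_printNullWorld θ).2 hu hf hv s⟩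

/-! ### Addendum (with ls-barrier-p4): priced B-len worlds are print-consistent; the two negations -/

/-- Every off-diagonal FORM of B-len's bookkeeping (`KnifeEdge.OffDiagForm θ X`, p458017: zero below the wall,
sesquilinear in the scalars) is print-consistent — its `below_wall` field. [cite: Zhang2022LandauSiegel, §7 Prop 7.1 p.44, (7.2)] -/
theorem printConsistent_of_offDiagForm (h : OffDiagForm θ X) : PrintConsistent X :=
  fun u u' v v' hu hv => ⟨h.below_wall u u' v v' hu hv, h.below_wall v v' v v' hv hv⟩

/-- Print-consistency does NOT force the null beyond the wall: `X = 0` is print-consistent and closes for `θ > 1`.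
[cite: Zhang2022LandauSiegel, §7 Prop 7.1 p.44, (7.2); §2 (2.32)–(2.33)] -/
theorem not_forall_printConsistent_null (hθ : 1 < θ) : ¬ ∀ X : PairFunctional, PrintConsistent X → Null θ X :=
  fun h => (closesByPositivityOn_iff_not_nullOn.1 (closesByPositivity_iff_closesOn.1 (closesByPositivity_zero hθ)))
    (null_iff_nullOn.1 (h 0 printConsistent_zero))

/-- Print-consistency does NOT force closing beyond the wall either: the print-consistent null world closes nowhere
(every `θ`). [cite: Zhang2022LandauSiegel, §7 Prop 7.1 p.44, (7.2); §2 (2.32)–(2.33)] -/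
theorem not_forall_printConsistent_closes (θ : ℝ) :
    ¬ ∀ X : PairFunctional, PrintConsistent X → ClosesByPositivity θ X :=
  fun h => not_closes_of_invisible (invisibleOverhang_printNullWorld θ) (h _ (printConsistent_printNullWorld θ))

end Repair

end Literature.NumberTheory.LFunctions.Zhang2022
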